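import Mathlib
import Summits.NavierStokesRegularity.NavierStokesRegularity.Theorems.EulerZoomLiouvillePowerGaugeEulerLiouvilleChannelClock
import Summits.NavierStokesRegularity.NavierStokesRegularity.Theorems.EulerZoomLiouvillePowerGaugeEulerLiouvilleNeedleClockPast
import Summits.NavierStokesRegularity.NavierStokesRegularity.Theorems.EulerZoomLiouvillePowerGaugeEulerLiouvilleSelfSimilarPastStrata
import HarnessLib

/-!
# «ANY FAST CHANNEL KILLS», III (past-exact twin): a far one-sided vortical channel at ANY rate kills a past-exact `C²` member
# (crux `EulerZoomLiouville.PowerGaugeEulerLiouville` = stmt-NavierStokesRegularity-19832, stratum `IsPastSelfSimilarClassical`, line `birth`)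

Route `EulerZoomLiouville` (NavierStokesRegularity), crux E, LEAD seat ns-typeII-p2 g13 (own brick).  By-name assembly, for members that are
EXACTLY SELF-SIMILAR ABOUT `(T, x₀)` ONLY FOR `τ < T₁` (`T₁ ≤ 0`, `T₁ ≤ T`), of

* the class-free clock `ChannelClock.logClock_of_channel` (this seat, `…ChannelClock`): a one-sided vortical Bernoulli channel of the `C²` profile at ANY
  rate `c₁ > 0` is a LOG RESIDENCE CLOCK with `s₁ = 1/c₁ + 2`;
* the classical profile pressure of a past-exact member (`Past.exists_isSelfSimilarEulerProfile`, ns-typeII-p2 g9);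
* ns-ezl-w4 g4's past twin of the threshold, `NeedleRace.selfSimilar_ae_eq_zero_of_logClockC2_past` (`…NeedleClockPast`, p648147): every log clock kills.

* **`Past.selfSimilar_ae_eq_zero_of_vorticalChannelC2_profile_anyRate_past`** — the hypotheses of ns-ezl-w5 g2's
  `Past.selfSimilar_ae_eq_zero_of_vorticalFastChannelC2_profile_free_past` (p645615) VERBATIM with `1/((2+ρ)(1+ρ)) < c₁` REPLACED BY `0 < c₁`.

For the skeleton (LEAD, v83): the past disjunct's channel alternative (`IsPastSelfSimilarClassical`, predicate `HasFastVorticalChannel ρ V` on the past profile)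
keeps working after the threshold drops to `0 < c₁` (filler: this theorem, same remaining arguments).
WHAT THIS IS NOT: not NS, not E — a stratum on the model lattice; 19832 OPEN; NS regularity is NOT proved. [folklore; ConstantinIgnatovaVicol2026Putative §3.4–§3.5]
-/

noncomputable section

-- flat `Theorems/<Route><Decl>…` files of one crux share the namespace of the crux (tree convention: `Summit.<S>.<S>.…`)
set_option linter.dupNamespace false

open Set Filter Topology Metric Function MeasureTheory
open scoped RealInnerProductSpace NNReal ENNReal

namespace Summit.NavierStokesRegularity.NavierStokesRegularity.Theorems.PowerGaugeEulerLiouville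

open Literature.Analysis Literature.Analysis.FluidPDE

namespace Past

variable {ρ T T₁ : ℝ}
  {u : ℝ → EuclideanSpace ℝ (Fin 3) → EuclideanSpace ℝ (Fin 3)} {p : ℝ → EuclideanSpace ℝ (Fin 3) → ℝ}
  {H : ℝ → EuclideanSpace ℝ (Fin 3) → EuclideanSpace ℝ (Fin 3) →L[ℝ] EuclideanSpace ℝ (Fin 3)} {c : ℝ≥0}
  {V : EuclideanSpace ℝ (Fin 3) → EuclideanSpace ℝ (Fin 3)} {P : EuclideanSpace ℝ (Fin 3) → ℝ}

/-- **PAST-EXACT MEMBER WHOSE `C²` PROFILE HAS A FAR ONE-SIDED VORTICAL BERNOULLI CHANNEL AT ANY RATE `c₁ > 0` IS TRIVIAL** (crux hypotheses verbatim,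
`0 < ρ ≤ ½`; exact self-similarity about `(T, x₀)` for `τ < T₁`, `T₁ ≤ 0`, `T₁ ≤ T`; `V ∈ C²`; for every classical pressure `P′` of `V` and every level `h` a
radius beyond which every VORTICAL point of `{ℋ_{P′} > h}` has `⟪y, γy + V y⟫ ≤ −c₁‖y‖²`).  = ns-ezl-w5 g2's `…vorticalFastChannelC2_profile_free_past` with
`1/((2+ρ)(1+ρ)) < c₁` weakened to `0 < c₁`; proof = classical pressure ⇒ channel clock ⇒ the past log-clock threshold.
[folklore; ConstantinIgnatovaVicol2026Putative §3.4–§3.5] -/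
theorem selfSimilar_ae_eq_zero_of_vorticalChannelC2_profile_anyRate_past (hρ : 0 < ρ) (hρh : ρ ≤ 1 / 2) (hT₁ : T₁ ≤ 0)
    (hTT₁ : T₁ ≤ T) (x₀ : EuclideanSpace ℝ (Fin 3))
    (hsw : IsSuitableWeakSolutionOn (slab (EuclideanSpace ℝ (Fin 3)) (Iio 0) isOpen_Iio) 0 0 u p)
    (hH : HasWeakSpatialGradientOn (slab (EuclideanSpace ℝ (Fin 3)) (Iio 0) isOpen_Iio) u H)
    (hgauge : ∀ a : ℝ, 0 < a →
      ENNReal.ofReal (a ^ (2 * ρ)) * cknA a (0 : ℝ × EuclideanSpace ℝ (Fin 3)) u +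
          ENNReal.ofReal (a ^ ρ) * cknE a (0 : ℝ × EuclideanSpace ℝ (Fin 3)) H +
        ENNReal.ofReal (a ^ (2 * ρ)) * cknD a (0 : ℝ × EuclideanSpace ℝ (Fin 3)) p ≤ (c : ℝ≥0∞))
    (hu : ∀ τ : ℝ, τ < T₁ → u τ = fun x => selfSimilarCollapse (1 / (2 + ρ)) T V τ (x - x₀))
    (hp : ∀ τ : ℝ, τ < T₁ → p τ = fun x => selfSimilarCollapsePressure (1 / (2 + ρ)) T P τ (x - x₀))
    (hV : ContDiff ℝ 2 V) {c₁ : ℝ} (hc₁ : 0 < c₁)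
    (hB : ∀ P' : EuclideanSpace ℝ (Fin 3) → ℝ, IsSelfSimilarEulerProfile (1 / (2 + ρ)) 0 V P' →
      ∀ h : ℝ, ∃ R₀ : ℝ, ∀ y : EuclideanSpace ℝ (Fin 3), R₀ ≤ ‖y‖ →
        h < selfSimilarBernoulli (1 / (2 + ρ)) 0 V P' y → curl V y ≠ 0 →
          ⟪y, selfSimilarTransport (1 / (2 + ρ)) 0 V y⟫ ≤ -(c₁ * ‖y‖ ^ 2)) :
    uncurry u =ᵐ[volume.restrict (Iio (0 : ℝ) ×ˢ (univ : Set (EuclideanSpace ℝ (Fin 3))))] 0 := by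
  -- ### a classical pressure for the profile (far-past extension)
  obtain ⟨P', hprof⟩ := exists_isSelfSimilarEulerProfile hρ hT₁ hTT₁ hsw.distributional hu hp hV
  -- ### the channel is a log residence clock with `s₁ = 1/c₁ + 2`
  have hclock := ChannelClock.logClock_of_channel hρ hρh hprof hc₁ (hB P' hprof)
  have hs₁ : (0 : ℝ) ≤ 1 / c₁ + 2 := by positivity
  -- ### every log clock kills (past twin)
  exact NeedleRace.selfSimilar_ae_eq_zero_of_logClockC2_past hρ hρh hT₁ hTT₁ x₀ hsw hH hgauge hu hp hV hs₁ hclock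

end Past

end Summit.NavierStokesRegularity.NavierStokesRegularity.Theorems.PowerGaugeEulerLiouville

end
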